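import Literature.Barriers.RiemannHypothesis.EpsteinZetaRealZerosPairGroupingLow
import HarnessLib

/-!
# Low's grouping with TWO partner classes: the principal Epstein zeta function in a group of three

Barrier audit (D-0021) of `Literature.Barriers.RiemannHypothesis.EpsteinZetaRealZeros`, continued
(generation 9, 2026-08-27). Everything in this file is PROVED (theorems only).

`EpsteinZetaRealZerosPairGrouping.lean` groups the principal class of `−d` with ONE partner class. From
`d = 483` on (`h(−483) = 4`: no single partner compensates the principal class `(1, 1, 121)` of height
`√483/2 = 10.99`) the principal class must be grouped with TWO partners (`(3, 3, 41)` and `(7, 7, 19)`;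
or, for `h = 3` discriminants such as `499`, the two classes `(a, ±b, c)` of equal height). The
elementary inequality is the same weighted-mean inequality with three heights
`y₁ ≥ y₂ ≥ y₃ ≥ 1`; the weights `λ_i(u) ∝ y_i^{(1−u)/2}` now need TWO cell bounds: `λ₁ ≤ 1/(1 + ρ₂ + ρ₃)`
(`ρ_i ≤ (y_i/y₁)^{(1−p)/2}`) and `λ₁ + λ₂ ≤ (1 + R₂)/(1 + R₂ + ρ₃)` (`R₂ ≥ (y₂/y₁)^{(1−q)/2}`), after
which Abel summation over the ordered data `X₁ ≥ X₂ ≥ X₃` gives the single rational check of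
`triple_cell`.

## Results

* `triple_cell` — the three-height cell lemma (integer-power certificates, `norm_num`-decidable).
* `re_Λ_add3_lt_of_key` — analytic core (`M = 0.0236`): `Re Λ_{z₁} + Re Λ_{z₂} + Re Λ_{z₃} < −6δ`.
* `re_add3_neg_of_Ioo_half_one` — extension to `(0, 1)` (reflection; `σ = ½` by continuity).
* `triple_re_neg_of_Λ` — transfer to arbitrary continuations of three forms of one discriminant.
* `LFunction_re_pos_of_triple` — `Re L(σ, χ_{−d}) > 0` on `(0, 1)` for `4 < d ≤ 576` once the
  principal class grouped with two distinct reduced classes (`a ≥ 2`) is negative on `(0, 1)`.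

## References

* [Low1968] M. E. Low, Acta Arith. 14 (1968) 117–140, Theorem 5 (via MR 38#4425).
* [Watkins2004RealZeros] M. Watkins, Math. Comp. 73 (2004) 415–423, Theorem (p. 416).
* [BatemanGrosswald1964] P. T. Bateman, E. Grosswald, Acta Arith. 9 (1964) 365–373, Theorem 1 (3)–(5).
-/

noncomputable section

open Complex Filter Topology MeasureTheory Set HurwitzZeta
open scoped UpperHalfPlane

namespace Literature.Barriers.RiemannHypothesis

open Literature.NumberTheory.Automorphic
open Literature.NumberTheory.LFunctions.RealZeros

/-! ## The three-height cell lemma -/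

/-- Weighted means of three ordered values with bounded weight ratios: if `ρ₂w₁ ≤ w₂ ≤ R₂w₁`,
`ρ₃w₁ ≤ w₃` (`w_i, ρ_i > 0`, `R₂ ≥ 0`) and `A₃ ≤ A₂ ≤ A₁`, then
`(w₁A₁ + w₂A₂ + w₃A₃)/(w₁ + w₂ + w₃) ≤ A₃ + (1+R₂)/(1+R₂+ρ₃)·(A₂ − A₃) + 1/(1+ρ₂+ρ₃)·(A₁ − A₂)`
(Abel summation). [folklore] -/
private theorem weightedMean3_le {w₁ w₂ w₃ ρ₂ ρ₃ R₂ A₁ A₂ A₃ : ℝ} (hw1 : 0 < w₁) (hw2 : 0 < w₂)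
    (hw3 : 0 < w₃) (hρ2 : 0 < ρ₂) (hρ3 : 0 < ρ₃) (hR : 0 ≤ R₂) (h2 : ρ₂ * w₁ ≤ w₂)
    (h3 : ρ₃ * w₁ ≤ w₃) (h2' : w₂ ≤ R₂ * w₁) (hA32 : A₃ ≤ A₂) (hA21 : A₂ ≤ A₁) :
    (w₁ * A₁ + w₂ * A₂ + w₃ * A₃) / (w₁ + w₂ + w₃) ≤
      A₃ + (1 + R₂) / (1 + R₂ + ρ₃) * (A₂ - A₃) + 1 / (1 + ρ₂ + ρ₃) * (A₁ - A₂) := by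
  have hW : 0 < w₁ + w₂ + w₃ := by linarith
  -- Abel summation
  have e : (w₁ * A₁ + w₂ * A₂ + w₃ * A₃) / (w₁ + w₂ + w₃) =
      A₃ + (w₁ + w₂) / (w₁ + w₂ + w₃) * (A₂ - A₃) + w₁ / (w₁ + w₂ + w₃) * (A₁ - A₂) := by
    field_simp
    ring
  rw [e]
  -- the two weight bounds
  have hL1 : w₁ / (w₁ + w₂ + w₃) ≤ 1 / (1 + ρ₂ + ρ₃) := by
    rw [div_le_div_iff₀ hW (by linarith)]
    nlinarith
  have hL12 : (w₁ + w₂) / (w₁ + w₂ + w₃) ≤ (1 + R₂) / (1 + R₂ + ρ₃) := by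
    rw [div_le_div_iff₀ hW (by positivity)]
    have h3' : (w₁ + w₂) * ρ₃ ≤ (1 + R₂) * w₃ := by nlinarith
    nlinarith
  have hA1 : 0 ≤ A₁ - A₂ := by linarith
  have hA2 : 0 ≤ A₂ - A₃ := by linarith
  have := mul_le_mul_of_nonneg_right hL1 hA1
  have := mul_le_mul_of_nonneg_right hL12 hA2
  linarith

/-- **The three-height cell lemma.** Heights `1 ≤ y₃ ≤ y₂ ≤ y₁` with `y₂ = r₂y₁`, `y₃ = r₃y₁`
(`r₂ ≤ 1`), a cell `p ≤ u ≤ q` in `(0, 1)`, rational data `y_i ≤ Y_i`, `Y_i^q ≤ X_i`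
(`0 ≤ X₃ ≤ X₂ ≤ X₁`), weight bounds `0 < ρ_i ≤ r_i^{(1−p)/2}` and `r₂^{(1−q)/2} ≤ R₂`, all as
integer-power certificates, and
`X = X₃ + (1+R₂)/(1+R₂+ρ₃)·(X₂ − X₃) + 1/(1+ρ₂+ρ₃)·(X₁ − X₂)`. The single check
`(1 − p)[(X − 1)/q + (1 + q)(M(X + 1) + β)] ≤ 2` gives
`P(u)Σ_i y_i^{(1+u)/2} + (N(u) + β)Σ_i y_i^{(1−u)/2} ≤ 0`. [cite: Low1968, Theorem 5 (via MR 38#4425)] -/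
theorem triple_cell {y₁ y₂ y₃ r₂ r₃ ρ₂ ρ₃ R₂ Y₁ Y₂ Y₃ X₁ X₂ X₃ X p q u M β : ℝ}
    {kq nq ke ne kR nR : ℕ}
    (hy3 : 1 ≤ y₃) (h32 : y₃ ≤ y₂) (h21 : y₂ ≤ y₁) (hr2 : y₂ = r₂ * y₁) (hr3 : y₃ = r₃ * y₁)
    (hr21 : r₂ ≤ 1)
    (hY1 : y₁ ≤ Y₁) (hY2 : y₂ ≤ Y₂) (hY3 : y₃ ≤ Y₃) (hnq : nq ≠ 0) (hq : q * nq = kq)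
    (hX1 : Y₁ ^ kq ≤ X₁ ^ nq) (hX2 : Y₂ ^ kq ≤ X₂ ^ nq) (hX3 : Y₃ ^ kq ≤ X₃ ^ nq)
    (hX30 : 0 ≤ X₃) (hX32 : X₃ ≤ X₂) (hX21 : X₂ ≤ X₁)
    (hρ20 : 0 < ρ₂) (hρ30 : 0 < ρ₃) (hne : ne ≠ 0) (he : (1 - p) / 2 * ne = ke)
    (hρ2 : ρ₂ ^ ne ≤ r₂ ^ ke) (hρ3 : ρ₃ ^ ne ≤ r₃ ^ ke)
    (hnR : nR ≠ 0) (heR : (1 - q) / 2 * nR = kR) (hR0 : 0 ≤ R₂) (hR2 : r₂ ^ kR ≤ R₂ ^ nR)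
    (hpu : p ≤ u) (hu0 : 0 < u) (huq : u ≤ q) (hu1 : u < 1) (hM : 0 ≤ M) (hβ : 0 ≤ β)
    (hXdef : X = X₃ + (1 + R₂) / (1 + R₂ + ρ₃) * (X₂ - X₃) + 1 / (1 + ρ₂ + ρ₃) * (X₁ - X₂))
    (hcell : (1 - p) * ((X - 1) / q + (1 + q) * (M * (X + 1) + β)) ≤ 2) :
    (M - 1 / (1 + u) + 1 / u) * (y₁ ^ ((1 + u) / 2) + y₂ ^ ((1 + u) / 2) + y₃ ^ ((1 + u) / 2)) +
      (M - 1 / (1 - u) - 1 / u + β) *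
        (y₁ ^ ((1 - u) / 2) + y₂ ^ ((1 - u) / 2) + y₃ ^ ((1 - u) / 2)) ≤ 0 := by
  have hy2 : 1 ≤ y₂ := hy3.trans h32
  have hy1 : 1 ≤ y₁ := hy2.trans h21
  have hy10 : 0 < y₁ := by linarith
  have hy20 : 0 < y₂ := by linarith
  have hy30 : 0 < y₃ := by linarith
  have hq0 : 0 < q := lt_of_lt_of_le hu0 huq
  have hr20 : 0 < r₂ := by
    by_contra h
    have : y₂ ≤ 0 := by rw [hr2]; exact mul_nonpos_of_nonpos_of_nonneg (not_lt.1 h) hy10.le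
    linarith
  have hr30 : 0 < r₃ := by
    by_contra h
    have : y₃ ≤ 0 := by rw [hr3]; exact mul_nonpos_of_nonpos_of_nonneg (not_lt.1 h) hy10.le
    linarith
  have hr31 : r₃ ≤ 1 := by
    have : r₃ * y₁ ≤ 1 * y₁ := by rw [← hr3, one_mul]; exact h32.trans h21
    exact le_of_mul_le_mul_right this hy10
  -- certificates as real-power bounds
  replace hX1 : Y₁ ^ q ≤ X₁ := rpow_le_of_pow_le (by linarith) (hX30.trans (hX32.trans hX21)) hnq hq hX1
  replace hX2 : Y₂ ^ q ≤ X₂ := rpow_le_of_pow_le (by linarith) (hX30.trans hX32) hnq hq hX2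
  replace hX3 : Y₃ ^ q ≤ X₃ := rpow_le_of_pow_le (by linarith) hX30 hnq hq hX3
  replace hρ2 : ρ₂ ≤ r₂ ^ ((1 - p) / 2) := le_rpow_of_pow_le hr20.le hρ20.le hne he hρ2
  replace hρ3 : ρ₃ ≤ r₃ ^ ((1 - p) / 2) := le_rpow_of_pow_le hr30.le hρ30.le hne he hρ3
  replace hR2 : r₂ ^ ((1 - q) / 2) ≤ R₂ := rpow_le_of_pow_le hr20.le hR0 hnR heR hR2
  -- weights and powers
  set w₁ : ℝ := y₁ ^ ((1 - u) / 2) with hw₁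
  set w₂ : ℝ := y₂ ^ ((1 - u) / 2) with hw₂
  set w₃ : ℝ := y₃ ^ ((1 - u) / 2) with hw₃
  set x₁ : ℝ := y₁ ^ u with hx₁
  set x₂ : ℝ := y₂ ^ u with hx₂
  set x₃ : ℝ := y₃ ^ u with hx₃
  have hw10 : 0 < w₁ := Real.rpow_pos_of_pos hy10 _
  have hw20 : 0 < w₂ := Real.rpow_pos_of_pos hy20 _
  have hw30 : 0 < w₃ := Real.rpow_pos_of_pos hy30 _
  have hW : 0 < w₁ + w₂ + w₃ := by linarith
  have e1 : y₁ ^ ((1 + u) / 2) = w₁ * x₁ := by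
    rw [hw₁, hx₁, ← Real.rpow_add hy10]; congr 1; ring
  have e2 : y₂ ^ ((1 + u) / 2) = w₂ * x₂ := by
    rw [hw₂, hx₂, ← Real.rpow_add hy20]; congr 1; ring
  have e3 : y₃ ^ ((1 + u) / 2) = w₃ * x₃ := by
    rw [hw₃, hx₃, ← Real.rpow_add hy30]; congr 1; ring
  -- weight ratio bounds
  have hexp : (1 - u) / 2 ≤ (1 - p) / 2 := by linarith
  have hexp' : (1 - q) / 2 ≤ (1 - u) / 2 := by linarith
  have hw2eq : w₂ = r₂ ^ ((1 - u) / 2) * w₁ := by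
    rw [hw₂, hw₁, hr2, Real.mul_rpow hr20.le hy10.le]
  have hw3eq : w₃ = r₃ ^ ((1 - u) / 2) * w₁ := by
    rw [hw₃, hw₁, hr3, Real.mul_rpow hr30.le hy10.le]
  have hρw2 : ρ₂ * w₁ ≤ w₂ := by
    rw [hw2eq]
    exact mul_le_mul_of_nonneg_right
      (hρ2.trans (Real.rpow_le_rpow_of_exponent_ge hr20 hr21 hexp)) hw10.le
  have hρw3 : ρ₃ * w₁ ≤ w₃ := by
    rw [hw3eq]
    exact mul_le_mul_of_nonneg_right
      (hρ3.trans (Real.rpow_le_rpow_of_exponent_ge hr30 hr31 hexp)) hw10.le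
  have hRw2 : w₂ ≤ R₂ * w₁ := by
    rw [hw2eq]
    exact mul_le_mul_of_nonneg_right
      ((Real.rpow_le_rpow_of_exponent_ge hr20 hr21 hexp').trans hR2) hw10.le
  -- `1 ≤ x_i ≤ X_i` and secant bounds
  have hx1one : 1 ≤ x₁ := Real.one_le_rpow hy1 hu0.le
  have hx2one : 1 ≤ x₂ := Real.one_le_rpow hy2 hu0.le
  have hx3one : 1 ≤ x₃ := Real.one_le_rpow hy3 hu0.le
  have bX : ∀ {y Y Xi : ℝ}, 1 ≤ y → y ≤ Y → Y ^ q ≤ Xi → y ^ u ≤ Xi := by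
    intro y Y Xi h1 hY hXi
    calc y ^ u ≤ y ^ q := Real.rpow_le_rpow_of_exponent_le h1 huq
      _ ≤ Y ^ q := Real.rpow_le_rpow (by linarith) hY hq0.le
      _ ≤ Xi := hXi
  have bD : ∀ {y Y Xi : ℝ}, 1 ≤ y → y ≤ Y → Y ^ q ≤ Xi → (y ^ u - 1) / u ≤ (Xi - 1) / q := by
    intro y Y Xi h1 hY hXi
    calc (y ^ u - 1) / u ≤ (y ^ q - 1) / q := rpow_sub_one_div_le h1 hu0 huq
      _ ≤ (Xi - 1) / q := by
          apply div_le_div_of_nonneg_right _ hq0.le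
          linarith [(Real.rpow_le_rpow (by linarith : (0:ℝ) ≤ y) hY hq0.le).trans hXi]
  have hx1X : x₁ ≤ X₁ := bX hy1 hY1 hX1
  have hx2X : x₂ ≤ X₂ := bX hy2 hY2 hX2
  have hx3X : x₃ ≤ X₃ := bX hy3 hY3 hX3
  have hD1 : (x₁ - 1) / u ≤ (X₁ - 1) / q := bD hy1 hY1 hX1
  have hD2 : (x₂ - 1) / u ≤ (X₂ - 1) / q := bD hy2 hY2 hX2
  have hD3 : (x₃ - 1) / u ≤ (X₃ - 1) / q := bD hy3 hY3 hX3
  -- the weighted mean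
  set m : ℝ := (w₁ * x₁ + w₂ * x₂ + w₃ * x₃) / (w₁ + w₂ + w₃) with hmdef
  have hm1 : 1 ≤ m := by
    rw [hmdef, le_div_iff₀ hW]
    have h1 := mul_le_mul_of_nonneg_left hx1one hw10.le
    have h2 := mul_le_mul_of_nonneg_left hx2one hw20.le
    have h3 := mul_le_mul_of_nonneg_left hx3one hw30.le
    linarith
  have hmX : m ≤ X := by
    calc m ≤ (w₁ * X₁ + w₂ * X₂ + w₃ * X₃) / (w₁ + w₂ + w₃) := by
          rw [hmdef]
          refine div_le_div_of_nonneg_right ?_ hW.le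
          have h1 := mul_le_mul_of_nonneg_left hx1X hw10.le
          have h2 := mul_le_mul_of_nonneg_left hx2X hw20.le
          have h3 := mul_le_mul_of_nonneg_left hx3X hw30.le
          linarith
      _ ≤ X₃ + (1 + R₂) / (1 + R₂ + ρ₃) * (X₂ - X₃) + 1 / (1 + ρ₂ + ρ₃) * (X₁ - X₂) :=
          weightedMean3_le hw10 hw20 hw30 hρ20 hρ30 hR0 hρw2 hρw3 hRw2 hX32 hX21
      _ = X := hXdef.symm
  have hmD : (m - 1) / u ≤ (X - 1) / q := by
    have em : (m - 1) / u =
        (w₁ * ((x₁ - 1) / u) + w₂ * ((x₂ - 1) / u) + w₃ * ((x₃ - 1) / u)) / (w₁ + w₂ + w₃) := by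
      rw [hmdef]; field_simp; ring
    have eX : (X - 1) / q = (X₃ - 1) / q + (1 + R₂) / (1 + R₂ + ρ₃) * ((X₂ - 1) / q - (X₃ - 1) / q) +
        1 / (1 + ρ₂ + ρ₃) * ((X₁ - 1) / q - (X₂ - 1) / q) := by
      rw [hXdef]; field_simp; ring
    rw [em, eX]
    calc (w₁ * ((x₁ - 1) / u) + w₂ * ((x₂ - 1) / u) + w₃ * ((x₃ - 1) / u)) / (w₁ + w₂ + w₃)
        ≤ (w₁ * ((X₁ - 1) / q) + w₂ * ((X₂ - 1) / q) + w₃ * ((X₃ - 1) / q)) / (w₁ + w₂ + w₃) := by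
          refine div_le_div_of_nonneg_right ?_ hW.le
          have h1 := mul_le_mul_of_nonneg_left hD1 hw10.le
          have h2 := mul_le_mul_of_nonneg_left hD2 hw20.le
          have h3 := mul_le_mul_of_nonneg_left hD3 hw30.le
          linarith
      _ ≤ _ := weightedMean3_le hw10 hw20 hw30 hρ20 hρ30 hR0 hρw2 hρw3 hRw2
            (div_le_div_of_nonneg_right (by linarith) hq0.le)
            (div_le_div_of_nonneg_right (by linarith) hq0.le)
  -- single-variable core with `x := m`
  have hmD0 : 0 ≤ (m - 1) / u := div_nonneg (by linarith) hu0.le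
  have hT0 : 0 ≤ M * (m + 1) + β := by positivity
  have hT : M * (m + 1) + β ≤ M * (X + 1) + β := by
    have := mul_le_mul_of_nonneg_left (add_le_add_right hmX 1) hM
    linarith
  have H : (1 - u) * ((m - 1) / u) + (1 - u) * (1 + u) * (M * (m + 1) + β) ≤ 2 := by
    calc (1 - u) * ((m - 1) / u) + (1 - u) * (1 + u) * (M * (m + 1) + β)
        ≤ (1 - p) * ((X - 1) / q) + (1 - p) * (1 + q) * (M * (X + 1) + β) := by
          refine add_le_add (mul_le_mul (by linarith) hmD hmD0 (by linarith)) ?_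
          exact mul_le_mul (mul_le_mul (by linarith) (by linarith) (by linarith) (by linarith))
            hT hT0 (mul_nonneg (by linarith) (by linarith))
      _ = (1 - p) * ((X - 1) / q + (1 + q) * (M * (X + 1) + β)) := by ring
      _ ≤ 2 := hcell
  have hcore := smallK_alg_core hu0 hu1 H
  have emW : m * (w₁ + w₂ + w₃) = w₁ * x₁ + w₂ * x₂ + w₃ * x₃ := by
    rw [hmdef]; field_simp
  rw [e1, e2, e3]
  have h1 := mul_le_mul_of_nonneg_right hcore hW.le
  have : (m * (M - 1 / (1 + u) + 1 / u) + β) * (w₁ + w₂ + w₃) =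
      (M - 1 / (1 + u) + 1 / u) * (w₁ * x₁ + w₂ * x₂ + w₃ * x₃) + β * (w₁ + w₂ + w₃) := by
    rw [← emW]; ring
  rw [this] at h1
  linarith

/-! ## The analytic core for three heights -/

/-- **Analytic core, three heights** (`M = 0.0236`): `1 ≤ y₃ ≤ y₂ ≤ y₁`, `½ < σ < 1`, Bessel
allowances `48√y_i e^{−1.4πy_i} ≤ 2β_i`, and the key inequality with `β = β₁ + β₂ + β₃ + δ` ⇒
`Re Λ_{z₁}(σ) + Re Λ_{z₂}(σ) + Re Λ_{z₃}(σ) < −6δ`. [cite: Low1968, Theorem 5 (via MR 38#4425)] -/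
theorem re_Λ_add3_lt_of_key (z₁ z₂ z₃ : ℍ) (hy3 : 1 ≤ z₃.im) (h32 : z₃.im ≤ z₂.im)
    (h21 : z₂.im ≤ z₁.im) {σ : ℝ} (hσ : 1 / 2 < σ) (hσ1 : σ < 1) {β₁ β₂ β₃ δ : ℝ}
    (hβ1 : 0 ≤ β₁) (hβ2 : 0 ≤ β₂) (hβ3 : 0 ≤ β₃) (hδ : 0 ≤ δ)
    (hE1 : 48 * Real.sqrt z₁.im * Real.exp (-(7 / 5) * Real.pi * z₁.im) ≤ 2 * β₁)
    (hE2 : 48 * Real.sqrt z₂.im * Real.exp (-(7 / 5) * Real.pi * z₂.im) ≤ 2 * β₂)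
    (hE3 : 48 * Real.sqrt z₃.im * Real.exp (-(7 / 5) * Real.pi * z₃.im) ≤ 2 * β₃)
    (hkey : (0.0236 - 1 / (1 + (2 * σ - 1)) + 1 / (2 * σ - 1)) *
        (z₁.im ^ σ + z₂.im ^ σ + z₃.im ^ σ) +
      (0.0236 - 1 / (1 - (2 * σ - 1)) - 1 / (2 * σ - 1) + (β₁ + β₂ + β₃ + δ)) *
        (z₁.im ^ (1 - σ) + z₂.im ^ (1 - σ) + z₃.im ^ (1 - σ)) ≤ 0) :
    ((thetaFEPair z₁).Λ σ).re + ((thetaFEPair z₂).Λ σ).re + ((thetaFEPair z₃).Λ σ).re <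
      -(6 * δ) := by
  have hy2 : 1 ≤ z₂.im := hy3.trans h32
  have hy1 : 1 ≤ z₁.im := hy2.trans h21
  have hS1 := re_Λ_lt_of_decomposition z₁ hy1 hσ hσ1 hE1
  have hS2 := re_Λ_lt_of_decomposition z₂ hy2 hσ hσ1 hE2
  have hS3 := re_Λ_lt_of_decomposition z₃ hy3 hσ hσ1 hE3
  have hw1 : 1 ≤ z₁.im ^ (1 - σ) := Real.one_le_rpow hy1 (by linarith)
  have hw2 : 1 ≤ z₂.im ^ (1 - σ) := Real.one_le_rpow hy2 (by linarith)
  have hw3 : 1 ≤ z₃.im ^ (1 - σ) := Real.one_le_rpow hy3 (by linarith)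
  have hβ : 0 ≤ β₁ + β₂ + β₃ + δ := by linarith
  have hkey' : (0.0236 - 1 / (1 + (2 * σ - 1)) + 1 / (2 * σ - 1)) *
        (z₁.im ^ σ + z₂.im ^ σ + z₃.im ^ σ) +
      (0.0236 - 1 / (1 - (2 * σ - 1)) - 1 / (2 * σ - 1)) *
        (z₁.im ^ (1 - σ) + z₂.im ^ (1 - σ) + z₃.im ^ (1 - σ)) ≤
      -((β₁ + β₂ + β₃ + δ) * (z₁.im ^ (1 - σ) + z₂.im ^ (1 - σ) + z₃.im ^ (1 - σ))) := by
    linarith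
  have habs : (β₁ + β₂ + β₃ + δ) * 3 ≤
      (β₁ + β₂ + β₃ + δ) * (z₁.im ^ (1 - σ) + z₂.im ^ (1 - σ) + z₃.im ^ (1 - σ)) :=
    mul_le_mul_of_nonneg_left (by linarith) hβ
  linarith

/-! ## From `(½, 1)` to `(0, 1)`, three summands -/

/-- **Extension to `(0, 1)`, three summands**: `< 0` on `(½, 1)` and `≤ −c` (`c > 0`) on
`(½, ½ + ε)` give `< 0` on `(0, 1)` (reflection `Λ_z(1 − s) = Λ_z(s)`; the point `½` by continuity
from the right). [cite: Low1968, Theorem 5 (via MR 38#4425)] -/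
theorem re_add3_neg_of_Ioo_half_one (z₁ z₂ z₃ : ℍ) {c ε : ℝ} (hc : 0 < c) (hε : 0 < ε)
    (hneg : ∀ σ : ℝ, 1 / 2 < σ → σ < 1 →
      ((thetaFEPair z₁).Λ σ).re + ((thetaFEPair z₂).Λ σ).re + ((thetaFEPair z₃).Λ σ).re < 0)
    (hnegc : ∀ σ : ℝ, 1 / 2 < σ → σ < 1 / 2 + ε →
      ((thetaFEPair z₁).Λ σ).re + ((thetaFEPair z₂).Λ σ).re + ((thetaFEPair z₃).Λ σ).re ≤ -c)
    {σ : ℝ} (hσ0 : 0 < σ) (hσ1 : σ < 1) :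
    ((thetaFEPair z₁).Λ σ).re + ((thetaFEPair z₂).Λ σ).re + ((thetaFEPair z₃).Λ σ).re < 0 := by
  rcases lt_trichotomy σ (1 / 2) with h | h | h
  · rw [← thetaFEPair_Λ_one_sub z₁ (σ : ℂ), ← thetaFEPair_Λ_one_sub z₂ (σ : ℂ),
      ← thetaFEPair_Λ_one_sub z₃ (σ : ℂ),
      show (1 : ℂ) - (σ : ℂ) = ((1 - σ : ℝ) : ℂ) by push_cast; ring]
    exact hneg (1 - σ) (by linarith) (by linarith)
  · subst h
    set g : ℝ → ℝ := fun t => ((thetaFEPair z₁).Λ t).re + ((thetaFEPair z₂).Λ t).re +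
      ((thetaFEPair z₃).Λ t).re with hg
    have hcont : ContinuousWithinAt g (Icc (1 / 2 : ℝ) (3 / 4)) (1 / 2) := by
      have h1 := continuousOn_re_Λ z₁ (σ₁ := 3 / 4) (by norm_num)
      have h2 := continuousOn_re_Λ z₂ (σ₁ := 3 / 4) (by norm_num)
      have h3 := continuousOn_re_Λ z₃ (σ₁ := 3 / 4) (by norm_num)
      exact ((h1.add h2).add h3) (1 / 2) ⟨le_rfl, by norm_num⟩
    have hcont' : ContinuousWithinAt g (Ioc (1 / 2 : ℝ) (3 / 4)) (1 / 2) :=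
      hcont.mono Ioc_subset_Icc_self
    have htend : Tendsto g (𝓝[>] (1 / 2 : ℝ)) (𝓝 (g (1 / 2))) := by
      have := hcont'.tendsto
      rwa [nhdsWithin_Ioc_eq_nhdsGT (by norm_num : (1 / 2 : ℝ) < 3 / 4)] at this
    have hev : ∀ᶠ t in 𝓝[>] (1 / 2 : ℝ), g t ≤ -c := by
      filter_upwards [Ioo_mem_nhdsGT (show (1 / 2 : ℝ) < 1 / 2 + ε by linarith)] with t ht
      exact hnegc t ht.1 ht.2
    have hle : g (1 / 2) ≤ -c := le_of_tendsto htend hev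
    have : g (1 / 2) = ((thetaFEPair z₁).Λ ((1 / 2 : ℝ) : ℂ)).re +
        ((thetaFEPair z₂).Λ ((1 / 2 : ℝ) : ℂ)).re + ((thetaFEPair z₃).Λ ((1 / 2 : ℝ) : ℂ)).re := rfl
    linarith
  · exact hneg σ h hσ1

/-! ## Transfer to three forms of one discriminant, and the class sum -/

variable {a₁ b₁ c₁ a₂ b₂ c₂ a₃ b₃ c₃ : ℝ}

/-- **Three classes of one discriminant**: negativity of `Re Λ_{z₁} + Re Λ_{z₂} + Re Λ_{z₃}` on
`(0, 1)` at the heights `k_i = √|d|/(2a_i)` gives `Re Z₁ + Re Z₂ + Re Z₃ < 0` on `(0, 1)` for all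
continuations (common completing factor). [cite: Low1968, Theorem 5 (via MR 38#4425)] -/
theorem triple_re_neg_of_Λ (h1 : IsPosDefForm a₁ b₁ c₁) (h2 : IsPosDefForm a₂ b₂ c₂)
    (h3 : IsPosDefForm a₃ b₃ c₃) (hD2 : 4 * a₁ * c₁ - b₁ ^ 2 = 4 * a₂ * c₂ - b₂ ^ 2)
    (hD3 : 4 * a₁ * c₁ - b₁ ^ 2 = 4 * a₃ * c₃ - b₃ ^ 2)
    (hΛ : ∀ z₁ z₂ z₃ : ℍ, z₁.im = starkK a₁ b₁ c₁ → z₂.im = starkK a₂ b₂ c₂ →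
      z₃.im = starkK a₃ b₃ c₃ → ∀ σ : ℝ, 0 < σ → σ < 1 →
      ((thetaFEPair z₁).Λ σ).re + ((thetaFEPair z₂).Λ σ).re + ((thetaFEPair z₃).Λ σ).re < 0)
    {Z₁ Z₂ Z₃ : ℂ → ℂ} (hZ1 : IsEpsteinContinuation a₁ b₁ c₁ Z₁)
    (hZ2 : IsEpsteinContinuation a₂ b₂ c₂ Z₂) (hZ3 : IsEpsteinContinuation a₃ b₃ c₃ Z₃)
    {σ : ℝ} (hσ0 : 0 < σ) (hσ1 : σ < 1) :
    (Z₁ σ).re + (Z₂ σ).re + (Z₃ σ).re < 0 := by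
  obtain ⟨z₁, hre1, him1, hk1⟩ := exists_zQ' h1
  obtain ⟨z₂, hre2, him2, hk2⟩ := exists_zQ' h2
  obtain ⟨z₃, hre3, him3, hk3⟩ := exists_zQ' h3
  have hZ1' : IsEpsteinContinuation c₁ b₁ a₁ Z₁ := (isEpsteinContinuation_swap_iff a₁ b₁ c₁ Z₁).2 hZ1
  have hZ2' : IsEpsteinContinuation c₂ b₂ a₂ Z₂ := (isEpsteinContinuation_swap_iff a₂ b₂ c₂ Z₂).2 hZ2
  have hZ3' : IsEpsteinContinuation c₃ b₃ a₃ Z₃ := (isEpsteinContinuation_swap_iff a₃ b₃ c₃ Z₃).2 hZ3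
  rw [continuation_ofReal_eq h1.swap z₁ hre1 him1 hZ1' hσ0 hσ1,
    continuation_ofReal_eq h2.swap z₂ hre2 him2 hZ2' hσ0 hσ1,
    continuation_ofReal_eq h3.swap z₃ hre3 him3 hZ3' hσ0 hσ1, Complex.re_ofReal_mul,
    Complex.re_ofReal_mul, Complex.re_ofReal_mul]
  have hD2' : (4 : ℝ) * c₂ * a₂ - b₂ ^ 2 = 4 * c₁ * a₁ - b₁ ^ 2 := by linarith
  have hD3' : (4 : ℝ) * c₃ * a₃ - b₃ ^ 2 = 4 * c₁ * a₁ - b₁ ^ 2 := by linarith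
  rw [hD2', hD3', ← mul_add, ← mul_add]
  exact mul_neg_of_pos_of_neg (realFactor_pos h1.swap hσ0) (hΛ z₁ z₂ z₃ hk1 hk2 hk3 σ hσ0 hσ1)

section ClassSum

open Literature.NumberTheory.QuadraticFields.BinaryQuadraticForm (reducedForms mem_reducedForms_iff
  le_of_isReduced discr_apply discr IsPrimitive IsReduced isPrimitive_one)
open Literature.NumberTheory.LFunctions (riemannZeta_im_eq_zero_of_pos riemannZeta_re_neg_of_pos_of_lt_one)

/-- The principal class is the only reduced class with `a = 1` (private copy). [folklore] -/
private theorem eq_of_mem_reducedForms_of_fst_eq_one' {D : ℤ} (hD : D < 0) {Q Q' : ℤ × ℤ × ℤ}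
    (hQ : Q ∈ reducedForms D) (hQ' : Q' ∈ reducedForms D) (h1 : Q.1 = 1) (h1' : Q'.1 = 1) :
    Q = Q' := by
  obtain ⟨a, b, c⟩ := Q
  obtain ⟨a', b', c'⟩ := Q'
  obtain ⟨hdisc, -, -, hb1, hb2, -, hb0⟩ := (mem_reducedForms_iff hD).1 hQ
  obtain ⟨hdisc', -, -, hb1', hb2', -, hb0'⟩ := (mem_reducedForms_iff hD).1 hQ'
  simp only at h1 h1' hb1 hb2 hb0 hb1' hb2' hb0'
  subst h1
  subst h1'
  rw [discr_apply] at hdisc hdisc'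
  have hb : b = 0 ∨ b = 1 := by omega
  have hb' : b' = 0 ∨ b' = 1 := by omega
  have hbb : b ^ 2 = b := by rcases hb with h | h <;> subst h <;> norm_num
  have hbb' : b' ^ 2 = b' := by rcases hb' with h | h <;> subst h <;> norm_num
  rw [hbb] at hdisc
  rw [hbb'] at hdisc'
  have hbe : b = b' := by omega
  subst hbe
  have hce : c = c' := by omega
  subst hce
  rfl

/-- Non-principal reduced classes of `−d`, `4 < d ≤ 576`, are negative on `(0, 1)` (private copy of
the pair file's lemma: `a ≥ 2` gives `4/5 ≤ k ≤ 6`). [folklore] -/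
private theorem re_neg_of_mem_reducedForms_of_two_le' {d : ℕ} (hd : 4 < d) (hd' : d ≤ 576)
    {a b c : ℤ} (hQ : (a, b, c) ∈ reducedForms (-(d : ℤ))) (ha2 : 2 ≤ a) {Z : ℂ → ℂ}
    (hZ : IsEpsteinContinuation (a : ℝ) (b : ℝ) (c : ℝ) Z) {σ : ℝ}
    (hσ0 : 0 < σ) (hσ1 : σ < 1) : (Z σ).re < 0 := by
  have hD0 : (-(d : ℤ)) < 0 := by omega
  obtain ⟨hdisc, ha, -, hred⟩ := (mem_reducedForms_iff hD0).1 hQ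
  obtain ⟨-, hb1, hb2, hac⟩ := le_of_isReduced hdisc ha hred
  simp only at ha
  rw [discr_apply] at hdisc
  have hbsq : b ^ 2 ≤ a ^ 2 := by nlinarith
  have h3a : 3 * a ^ 2 ≤ (d : ℤ) := by nlinarith
  have haR : (2 : ℝ) ≤ a := by exact_mod_cast ha2
  have hdR : (4 : ℝ) * a * c - (b : ℝ) ^ 2 = d := by
    exact_mod_cast (by linarith : 4 * a * c - b ^ 2 = (d : ℤ))
  have h3aR : 3 * (a : ℝ) ^ 2 ≤ d := by exact_mod_cast h3a
  have hd4R : (4 : ℝ) < d := by exact_mod_cast hd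
  have hd576 : (d : ℝ) ≤ 576 := by exact_mod_cast hd'
  have hpos : IsPosDefForm (a : ℝ) (b : ℝ) (c : ℝ) := ⟨by linarith, by linarith⟩
  have hk : starkK (a : ℝ) (b : ℝ) (c : ℝ) = Real.sqrt d / (2 * a) := by rw [starkK, hdR]
  have hsd24 : Real.sqrt d ≤ 24 := by
    rw [Real.sqrt_le_left (by norm_num)]; linarith
  have hk45 : 4 / 5 ≤ starkK (a : ℝ) (b : ℝ) (c : ℝ) := by
    rw [hk, le_div_iff₀ (by positivity), Real.le_sqrt' (by positivity)]
    nlinarith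
  have hk6 : starkK (a : ℝ) (b : ℝ) (c : ℝ) ≤ 6 := by
    rw [hk, div_le_iff₀ (by positivity)]
    nlinarith
  exact re_neg_of_starkK_le_six hpos hk45 hk6 hZ hσ0 hσ1

/-- **Low's grouping with two partners: `Re L(σ, χ) > 0` on ALL of `(0, 1)`** for the odd real
primitive character `χ` mod `d`, `4 < d ≤ 576`, provided the principal reduced class `(1, b₁, c₁)`
grouped with TWO distinct reduced classes `(a₂, b₂, c₂) ≠ (a₃, b₃, c₃)` (`a₂, a₃ ≥ 2`) of
discriminant `−d` is negative on `(0, 1)` for all continuations; the remaining classes are negative on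
their own, `ζ(σ) < 0`. [cite: Low1968, Theorem 5 (via MR 38#4425)] -/
theorem LFunction_re_pos_of_triple {d : ℕ} [NeZero d] (hd : 4 < d) (hd' : d ≤ 576)
    {χ : DirichletCharacter ℂ d} (hprim : χ.IsPrimitive) (hquad : χ.IsQuadratic) (hodd : χ.Odd)
    {b₁ c₁ a₂ b₂ c₂ a₃ b₃ c₃ : ℤ} (hdisc1 : discr ((1 : ℤ), b₁, c₁) = -(d : ℤ))
    (hred1 : IsReduced ((1 : ℤ), b₁, c₁)) (hdisc2 : discr (a₂, b₂, c₂) = -(d : ℤ))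
    (hprim2 : IsPrimitive (a₂, b₂, c₂)) (hred2 : IsReduced (a₂, b₂, c₂)) (ha2 : 2 ≤ a₂)
    (hdisc3 : discr (a₃, b₃, c₃) = -(d : ℤ)) (hprim3 : IsPrimitive (a₃, b₃, c₃))
    (hred3 : IsReduced (a₃, b₃, c₃)) (ha3 : 2 ≤ a₃) (h23 : (a₂, b₂, c₂) ≠ (a₃, b₃, c₃))
    (htriple : ∀ Z₁ Z₂ Z₃ : ℂ → ℂ, IsEpsteinContinuation (1 : ℝ) (b₁ : ℝ) (c₁ : ℝ) Z₁ →
      IsEpsteinContinuation (a₂ : ℝ) (b₂ : ℝ) (c₂ : ℝ) Z₂ →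
      IsEpsteinContinuation (a₃ : ℝ) (b₃ : ℝ) (c₃ : ℝ) Z₃ →
      ∀ σ : ℝ, 0 < σ → σ < 1 → (Z₁ σ).re + (Z₂ σ).re + (Z₃ σ).re < 0)
    {σ : ℝ} (hσ0 : 0 < σ) (hσ1 : σ < 1) : 0 < (χ.LFunction σ).re := by
  classical
  have hχ1 : χ ≠ 1 := by
    intro h
    have h1 : χ (-1) = -1 := hodd
    rw [h, MulChar.one_apply (isUnit_one.neg)] at h1
    norm_num at h1
  set S := reducedForms (-(d : ℤ)) with hS
  have hD0 : (-(d : ℤ)) < 0 := by omega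
  have hQ1 : ((1 : ℤ), b₁, c₁) ∈ S :=
    (mem_reducedForms_iff hD0).2 ⟨hdisc1, by norm_num, isPrimitive_one _ _, hred1⟩
  have hQ2 : (a₂, b₂, c₂) ∈ S :=
    (mem_reducedForms_iff hD0).2 ⟨hdisc2, by simp only; omega, hprim2, hred2⟩
  have hQ3 : (a₃, b₃, c₃) ∈ S :=
    (mem_reducedForms_iff hD0).2 ⟨hdisc3, by simp only; omega, hprim3, hred3⟩
  have huniq : ∀ Q ∈ S, Q.1 = 1 → Q = (1, b₁, c₁) := fun Q hQ h1 =>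
    eq_of_mem_reducedForms_of_fst_eq_one' hD0 hQ hQ1 h1 rfl
  -- continuations
  have hex : ∀ Q : ℤ × ℤ × ℤ, ∃ Z : ℂ → ℂ,
      Q ∈ S → IsEpsteinContinuation (Q.1 : ℝ) (Q.2.1 : ℝ) (Q.2.2 : ℝ) Z := by
    intro Q
    by_cases hQ : Q ∈ S
    · obtain ⟨hdisc, ha, -, hred⟩ := (mem_reducedForms_iff hD0).1 hQ
      obtain ⟨-, hb1, hb2, hac⟩ := le_of_isReduced (a := Q.1) (b := Q.2.1) (c := Q.2.2) hdisc ha hred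
      rw [show Q = (Q.1, Q.2.1, Q.2.2) from rfl, discr_apply] at hdisc
      have hd4R : (4 : ℝ) < d := by exact_mod_cast hd
      have hpos : IsPosDefForm (Q.1 : ℝ) (Q.2.1 : ℝ) (Q.2.2 : ℝ) := by
        refine ⟨by exact_mod_cast ha, ?_⟩
        have : (Q.2.1 : ℝ) ^ 2 - 4 * (Q.1 : ℝ) * (Q.2.2 : ℝ) = ((-(d : ℤ) : ℤ) : ℝ) := by
          exact_mod_cast hdisc
        rw [this]; push_cast; linarith
      obtain ⟨Z, hZ, -⟩ := MontgomeryVaughan2007_epsteinContinuation_holds _ _ _ hpos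
      exact ⟨Z, fun _ => hZ⟩
    · exact ⟨0, fun h => absurd h hQ⟩
  choose Z hZ using hex
  set G : ℂ → ℂ := fun s => 1 / 2 * ∑ Q ∈ S, Z Q s with hGdef
  set F : ℂ → ℂ := fun s => riemannZeta s * χ.LFunction s with hFdef
  have hU : IsOpen {s : ℂ | s ≠ 1} := isOpen_ne
  have hFd : DifferentiableOn ℂ F {s : ℂ | s ≠ 1} := fun s hs =>
    ((differentiableAt_riemannZeta hs).mul
      ((DirichletCharacter.differentiable_LFunction hχ1) s)).differentiableWithinAt
  have hGd : DifferentiableOn ℂ G {s : ℂ | s ≠ 1} :=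
    (differentiableOn_const _).mul (DifferentiableOn.fun_sum fun Q hQ => (hZ Q hQ).1)
  have hFG : EqOn F G {s : ℂ | s ≠ 1} := by
    refine (hFd.analyticOnNhd hU).eqOn_of_preconnected_of_eventuallyEq (hGd.analyticOnNhd hU)
      isPreconnected_compl_one (show (2 : ℂ) ∈ {s : ℂ | s ≠ 1} by norm_num) ?_
    have hopen : IsOpen {s : ℂ | 1 < s.re} := isOpen_lt continuous_const Complex.continuous_re
    filter_upwards [hopen.mem_nhds (show (2 : ℂ) ∈ {s : ℂ | 1 < s.re} by simp)] with s hs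
    have hs' : 1 < s.re := hs
    simp only [hFdef, hGdef]
    rw [riemannZeta_mul_LFunction_eq_half_sum_of_one_lt_re hd hprim hquad hodd hs']
    congr 1
    exact Finset.sum_congr rfl fun Q hQ => ((hZ Q hQ).2 s hs').symm
  have hσU : ((σ : ℂ)) ∈ {s : ℂ | s ≠ 1} := by
    simp only [Set.mem_setOf_eq]
    exact_mod_cast hσ1.ne
  have heq := hFG hσU
  simp only [hFdef, hGdef] at heq
  -- split off `Q₁, Q₂, Q₃`
  set Q₁ : ℤ × ℤ × ℤ := ((1 : ℤ), b₁, c₁) with hQ₁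
  set Q₂ : ℤ × ℤ × ℤ := (a₂, b₂, c₂) with hQ₂
  set Q₃ : ℤ × ℤ × ℤ := (a₃, b₃, c₃) with hQ₃
  have hne12 : Q₁ ≠ Q₂ := by
    intro h
    have := congrArg Prod.fst h
    simp only [hQ₁, hQ₂] at this
    omega
  have hne13 : Q₁ ≠ Q₃ := by
    intro h
    have := congrArg Prod.fst h
    simp only [hQ₁, hQ₃] at this
    omega
  have hQ2' : Q₂ ∈ S.erase Q₁ := Finset.mem_erase.2 ⟨hne12.symm, hQ2⟩
  have hQ3' : Q₃ ∈ (S.erase Q₁).erase Q₂ :=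
    Finset.mem_erase.2 ⟨fun h => h23 h.symm, Finset.mem_erase.2 ⟨hne13.symm, hQ3⟩⟩
  have hsum : ∑ Q ∈ S, (Z Q σ).re = (Z Q₁ σ).re + ((Z Q₂ σ).re + ((Z Q₃ σ).re +
      ∑ Q ∈ ((S.erase Q₁).erase Q₂).erase Q₃, (Z Q σ).re)) := by
    rw [← Finset.add_sum_erase S _ hQ1, ← Finset.add_sum_erase _ _ hQ2',
      ← Finset.add_sum_erase _ _ hQ3']
  have hrest : ∑ Q ∈ ((S.erase Q₁).erase Q₂).erase Q₃, (Z Q σ).re ≤ 0 := by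
    refine Finset.sum_nonpos fun Q hQ => ?_
    have hQ' := Finset.mem_of_mem_erase (Finset.mem_of_mem_erase hQ)
    have hQS : Q ∈ S := Finset.mem_of_mem_erase hQ'
    have hQ1ne : Q ≠ Q₁ := Finset.ne_of_mem_erase hQ'
    obtain ⟨-, ha, -, -⟩ := (mem_reducedForms_iff hD0).1 hQS
    have ha2' : 2 ≤ Q.1 := by
      by_contra hlt
      have h1 : Q.1 = 1 := by omega
      exact hQ1ne (huniq Q hQS h1)
    exact (re_neg_of_mem_reducedForms_of_two_le' hd hd' (a := Q.1) (b := Q.2.1) (c := Q.2.2) hQS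
      ha2' (hZ Q hQS) hσ0 hσ1).le
  have htriple' : (Z Q₁ σ).re + (Z Q₂ σ).re + (Z Q₃ σ).re < 0 := by
    have h1 := hZ Q₁ hQ1
    have h2 := hZ Q₂ hQ2
    have h3 := hZ Q₃ hQ3
    simp only [hQ₁, hQ₂, hQ₃, Int.cast_one] at h1 h2 h3
    exact htriple _ _ _ h1 h2 h3 σ hσ0 hσ1
  have hGneg : (1 / 2 * ∑ Q ∈ S, Z Q σ).re < 0 := by
    rw [show (1 : ℂ) / 2 = ((1 / 2 : ℝ) : ℂ) by push_cast; ring, Complex.re_ofReal_mul, Complex.re_sum,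
      hsum]
    have : (Z Q₁ σ).re + ((Z Q₂ σ).re + ((Z Q₃ σ).re +
        ∑ Q ∈ ((S.erase Q₁).erase Q₂).erase Q₃, (Z Q σ).re)) < 0 := by linarith
    exact mul_neg_of_pos_of_neg (by norm_num) this
  rw [← heq, Complex.mul_re, riemannZeta_im_eq_zero_of_pos hσ0 hσ1.ne, zero_mul, sub_zero] at hGneg
  exact pos_of_mul_neg_right hGneg (riemannZeta_re_neg_of_pos_of_lt_one hσ0 hσ1).le

end ClassSum

end Literature.Barriers.RiemannHypothesis
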